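import Literature.Analysis.FunctionSpaces.TorusLinearisedNSEnergy
import HarnessLib

/-!
# The linearised Navier–Stokes equation along a smooth field on the flat torus, II: pressure,
# anchors on convex time sets, exponential growth bound at integer times

Function-space support file (all results proved; no definitions, no named facts), sequel of
`TorusLinearisedNSEnergy` (energy identity, Grönwall and uniqueness on `[a, b]` for jointly smooth
solutions `(w, q)` of `∂ₜw + (u·∇)w + (w·∇)u = νΔw − ∇q`, `div w = 0`, along a jointly smooth
field `u` with divergence-free slices; Constantin–Foias 1988, Ch. 14, (14.2)–(14.6); Temam 1997,
Ch. VI §3.1, (3.7)–(3.11)). As there, no predicate is introduced and the clauses of the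
linearised problem are separate hypotheses.

## Contents

* `Torus.linearisedNS_gradient_pressure_eq`, `Torus.linearisedNS_pressure_sub_eq` — **the
  linearised velocity determines the pressure gradient** on any time set; pressures of two
  solutions with the same velocity differ by a function of time alone
  (cf. `Torus.IsClassicalNSSolutionOn.gradient_pressure_eq_of_eventuallyEq` for the nonlinear
  system, `TorusClassicalNSGluing`);
* `Torus.linearisedNS_mono` — restriction of the equation to a smaller time set of unique
  differentiability (`Torus.IsSmoothSpaceTimeOn.timeDerivWithin_eq_of_subset`);
* `Torus.linearisedNS_integral_norm_sq_le_mul_exp_of_mem`, `Torus.linearisedNS_unique_of_mem` —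
  the Grönwall bound `∫ ‖w(t)‖² ≤ (∫ ‖w(t₀)‖²) e^{2(∑ᵢ Cᵢ)(t − t₀)}` and forward uniqueness on a
  convex time set `S` from any anchor `t₀ ∈ S` (restrict to `[t₀, t] ⊆ S`);
* `Torus.linearisedNS_integral_norm_sq_nat_le_mul_exp`,
  `Torus.linearisedNS_integral_norm_sq_le_mul_exp_Ici`, `Torus.linearisedNS_unique_Ici` — on
  `S = [0, ∞)` with gradient bounds `‖∂ᵢu‖ ≤ Cᵢ` on `[0, ∞) × T^d` (as along trajectories in a
  compact invariant set of smooth states): `∫ ‖w(n)‖² ≤ (∫ ‖w(0)‖²) e^{2(∑ᵢ Cᵢ) n}` for every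
  `n : ℕ` (and every real `t ≥ 0`), and uniqueness of the linearised flow from its initial value.
  Thus the squared `L²` norm of every linearised solution grows at most exponentially with rate
  `K = 2 ∑ᵢ Cᵢ` — the Lyapunov exponents of the derivative cocycle `ξ ↦ v(t, u₀, ξ)`
  (Constantin–Foias 1988, (14.2)) are `≤ K/2`, the a-priori side of the sub-exponential-growth /
  exponential-decay dichotomy in hyperbolicity hypotheses on invariant measures.

Existence of linearised solutions, `H¹`/parabolic smoothing of the cocycle and backward
uniqueness (injectivity of the cocycle) are NOT treated here.

## References

* P. Constantin, C. Foias, *Navier–Stokes Equations*, Chicago Lectures in Math. (1988), Ch. 14,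
  (14.2)–(14.6). [`ConstantinFoiasNSE1988`]
* R. Temam, *Infinite-Dimensional Dynamical Systems in Mechanics and Physics*, 2nd ed., Springer
  (1997), Ch. VI §3.1, (3.7)–(3.11). [`Temam1997`]
-/

open MeasureTheory Set Filter
open scoped InnerProductSpace ContDiff Topology

noncomputable section

namespace Literature.Analysis.FunctionSpaces

namespace Torus

variable {d : Type*} [Fintype d] [DecidableEq d]

/-! ## The velocity determines the pressure gradient -/

section Pressure

variable {S : Set ℝ} {ν : ℝ} {u w₁ w₂ : ℝ → UnitAddTorus d → EuclideanSpace ℝ d}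
  {q₁ q₂ : ℝ → UnitAddTorus d → ℝ}

omit [Fintype d] [DecidableEq d] in
/-- Fields agreeing on the time set have the same one-sided time derivative within it (Mathlib
`derivWithin_congr`). [folklore] -/
theorem timeDerivWithin_congr_of_eqOn {F : Type*} [NormedAddCommGroup F] [NormedSpace ℝ F]
    {v₁ v₂ : ℝ → UnitAddTorus d → F} (heq : ∀ s ∈ S, v₁ s = v₂ s) {t : ℝ} (ht : t ∈ S)
    (x : UnitAddTorus d) : timeDerivWithin S v₁ t x = timeDerivWithin S v₂ t x :=
  derivWithin_congr (fun s hs => congrFun (heq s hs) x) (congrFun (heq t ht) x)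

omit [DecidableEq d] in
/-- **The linearised velocity determines the pressure gradient.** Two linearised solutions along
`u` on a time set `S` whose velocities agree on `S` have the same pressure gradient at every
`t ∈ S`: subtract the two equations (the one-sided time derivatives within `S` of fields agreeing
on `S` coincide, `Torus.timeDerivWithin_congr_of_eqOn`). [folklore] -/
theorem linearisedNS_gradient_pressure_eq
    (hlin₁ : ∀ t ∈ S, ∀ x, timeDerivWithin S w₁ t x + convect (u t) (w₁ t) x +
      convect (w₁ t) (u t) x = ν • laplacian (w₁ t) x - gradient (q₁ t) x)
    (hlin₂ : ∀ t ∈ S, ∀ x, timeDerivWithin S w₂ t x + convect (u t) (w₂ t) x +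
      convect (w₂ t) (u t) x = ν • laplacian (w₂ t) x - gradient (q₂ t) x)
    (heq : ∀ s ∈ S, w₁ s = w₂ s) {t : ℝ} (ht : t ∈ S) (x : UnitAddTorus d) :
    gradient (q₁ t) x = gradient (q₂ t) x := by
  have h₁ := hlin₁ t ht x
  have h₂ := hlin₂ t ht x
  rw [timeDerivWithin_congr_of_eqOn heq ht x, heq t ht] at h₁
  exact sub_right_injective (h₁.symm.trans h₂)

omit [DecidableEq d] in
/-- **Pressures of linearised solutions with the same velocity differ by a function of time**:
under the hypotheses of `Torus.linearisedNS_gradient_pressure_eq` and joint smoothness of the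
pressures, `q₁(t, x) − q₁(t, x₀) = q₂(t, x) − q₂(t, x₀)` for all `x, x₀` (the lift of
`q₁(t) − q₂(t)` to `ℝ^d` has vanishing derivative, `Torus.fderiv_lift`, `Torus.inner_gradient_left`,
hence is constant, Mathlib `is_const_of_fderiv_eq_zero`). [folklore] -/
theorem linearisedNS_pressure_sub_eq (hq₁ : IsSmoothSpaceTimeOn S q₁) (hq₂ : IsSmoothSpaceTimeOn S q₂)
    (hlin₁ : ∀ t ∈ S, ∀ x, timeDerivWithin S w₁ t x + convect (u t) (w₁ t) x +
      convect (w₁ t) (u t) x = ν • laplacian (w₁ t) x - gradient (q₁ t) x)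
    (hlin₂ : ∀ t ∈ S, ∀ x, timeDerivWithin S w₂ t x + convect (u t) (w₂ t) x +
      convect (w₂ t) (u t) x = ν • laplacian (w₂ t) x - gradient (q₂ t) x)
    (heq : ∀ s ∈ S, w₁ s = w₂ s) {t : ℝ} (ht : t ∈ S) (x x₀ : UnitAddTorus d) :
    q₁ t x - q₁ t x₀ = q₂ t x - q₂ t x₀ := by
  have hp₁ : IsSmooth (q₁ t) := hq₁.isSmooth_slice ht
  have hp₂ : IsSmooth (q₂ t) := hq₂.isSmooth_slice ht
  have hψ : IsSmooth (q₁ t - q₂ t) := hp₁.sub hp₂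
  have hg0 : ∀ y, Torus.gradient (q₁ t - q₂ t) y = 0 := fun y => by
    rw [gradient_sub (hp₁.isContDiff (by simp)) (hp₂.isContDiff (by simp)),
      linearisedNS_gradient_pressure_eq hlin₁ hlin₂ heq ht y, sub_self]
  have hD : Differentiable ℝ (lift (q₁ t - q₂ t)) := ContDiff.differentiable hψ (by simp)
  have hzero : ∀ y, _root_.fderiv ℝ (lift (q₁ t - q₂ t)) y = 0 := fun y => by
    rw [fderiv_lift]
    ext v
    rw [← inner_gradient_left, hg0]
    simp
  have hc := is_const_of_fderiv_eq_zero hD hzero (repr x) (repr x₀)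
  rw [lift_repr, lift_repr, Pi.sub_apply, Pi.sub_apply] at hc
  linarith

end Pressure

/-! ## Convex time sets: bounds and uniqueness from any anchor; integer times on `[0, ∞)` -/

section Anchors

variable {S : Set ℝ} {ν : ℝ} {u w w₁ w₂ : ℝ → UnitAddTorus d → EuclideanSpace ℝ d}
  {q q₁ q₂ : ℝ → UnitAddTorus d → ℝ}

omit [DecidableEq d] in
/-- **Restriction of the linearised equation to a smaller time set.** If the linearised equation
holds on `S` with the time derivative within `S`, it holds on any `S' ⊆ S` of unique
differentiability with the time derivative within `S'`
(`Torus.IsSmoothSpaceTimeOn.timeDerivWithin_eq_of_subset`). [folklore] -/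
theorem linearisedNS_mono {S' : Set ℝ} (hw : IsSmoothSpaceTimeOn S w)
    (hlin : ∀ t ∈ S, ∀ x, timeDerivWithin S w t x + convect (u t) (w t) x +
      convect (w t) (u t) x = ν • laplacian (w t) x - gradient (q t) x)
    (hS' : S' ⊆ S) (hU : UniqueDiffOn ℝ S') {t : ℝ} (ht : t ∈ S') (x : UnitAddTorus d) :
    timeDerivWithin S' w t x + convect (u t) (w t) x + convect (w t) (u t) x =
      ν • laplacian (w t) x - gradient (q t) x := by
  rw [hw.timeDerivWithin_eq_of_subset hS' hU ht x]
  exact hlin t (hS' ht) x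

/-- **Exponential `L²` bound from any anchor time.** Let `u` be jointly smooth with
divergence-free slices on a convex time set `S`, with `‖∂ᵢu(t, x)‖ ≤ Cᵢ` on `S × T^d`, and let
`(w, q)` solve the linearised equation along `u` on `S` (`ν ≥ 0`). Then for `t₀ ≤ t` in `S`,
`∫ ‖w(t)‖² ≤ (∫ ‖w(t₀)‖²) · exp(2(∑ᵢ Cᵢ)(t − t₀))` (restrict to `[t₀, t] ⊆ S` and apply
`Torus.linearisedNS_integral_norm_sq_le_mul_exp`). [folklore] -/
theorem linearisedNS_integral_norm_sq_le_mul_exp_of_mem (hν : 0 ≤ ν) (hS : Convex ℝ S)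
    (hu : IsSmoothSpaceTimeOn S u) (hudiv : ∀ t ∈ S, IsDivFree (u t))
    (hw : IsSmoothSpaceTimeOn S w) (hq : IsSmoothSpaceTimeOn S q)
    (hwdiv : ∀ t ∈ S, IsDivFree (w t))
    (hlin : ∀ t ∈ S, ∀ x, timeDerivWithin S w t x + convect (u t) (w t) x +
      convect (w t) (u t) x = ν • laplacian (w t) x - gradient (q t) x)
    {C : d → ℝ} (hC : ∀ i, ∀ t ∈ S, ∀ x, ‖partialDeriv i (u t) x‖ ≤ C i)
    {t₀ : ℝ} (ht₀ : t₀ ∈ S) {t : ℝ} (ht : t ∈ S) (ht₀t : t₀ ≤ t) :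
    ∫ x, ‖w t x‖ ^ 2 ≤ (∫ x, ‖w t₀ x‖ ^ 2) * Real.exp ((2 * ∑ i, C i) * (t - t₀)) := by
  rcases eq_or_lt_of_le ht₀t with rfl | hlt
  · rw [sub_self, mul_zero, Real.exp_zero, mul_one]
  · have hsub : Icc t₀ t ⊆ S := hS.ordConnected.out ht₀ ht
    have hU : UniqueDiffOn ℝ (Icc t₀ t) := uniqueDiffOn_Icc hlt
    exact linearisedNS_integral_norm_sq_le_mul_exp hν (hu.mono hsub) (fun s hs => hudiv s (hsub hs))
      (hw.mono hsub) (hq.mono hsub) (fun s hs => hwdiv s (hsub hs))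
      (fun s hs x => linearisedNS_mono hw hlin hsub hU hs x)
      (fun i s hs x => hC i s (hsub hs) x) ⟨hlt.le, le_rfl⟩

/-- **Forward uniqueness of linearised solutions from any anchor time.** Two linearised solutions
along the same smooth divergence-free `u` on a convex time set `S` (`ν ≥ 0`) which agree at
`t₀ ∈ S` agree at every later time of `S` (restrict to `[t₀, t] ⊆ S` and apply
`Torus.linearisedNS_unique`). [cite: Temam1997, Ch. VI §3.1 (3.11)] -/
theorem linearisedNS_unique_of_mem (hν : 0 ≤ ν) (hS : Convex ℝ S)
    (hu : IsSmoothSpaceTimeOn S u) (hudiv : ∀ t ∈ S, IsDivFree (u t))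
    (hw₁ : IsSmoothSpaceTimeOn S w₁) (hq₁ : IsSmoothSpaceTimeOn S q₁)
    (hwdiv₁ : ∀ t ∈ S, IsDivFree (w₁ t))
    (hlin₁ : ∀ t ∈ S, ∀ x, timeDerivWithin S w₁ t x + convect (u t) (w₁ t) x +
      convect (w₁ t) (u t) x = ν • laplacian (w₁ t) x - gradient (q₁ t) x)
    (hw₂ : IsSmoothSpaceTimeOn S w₂) (hq₂ : IsSmoothSpaceTimeOn S q₂)
    (hwdiv₂ : ∀ t ∈ S, IsDivFree (w₂ t))
    (hlin₂ : ∀ t ∈ S, ∀ x, timeDerivWithin S w₂ t x + convect (u t) (w₂ t) x +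
      convect (w₂ t) (u t) x = ν • laplacian (w₂ t) x - gradient (q₂ t) x)
    {t₀ : ℝ} (ht₀ : t₀ ∈ S) (h0 : w₁ t₀ = w₂ t₀) {t : ℝ} (ht : t ∈ S) (ht₀t : t₀ ≤ t) :
    w₁ t = w₂ t := by
  rcases eq_or_lt_of_le ht₀t with rfl | hlt
  · exact h0
  · have hsub : Icc t₀ t ⊆ S := hS.ordConnected.out ht₀ ht
    have hU : UniqueDiffOn ℝ (Icc t₀ t) := uniqueDiffOn_Icc hlt
    exact linearisedNS_unique hν (hu.mono hsub) (fun s hs => hudiv s (hsub hs))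
      (hw₁.mono hsub) (hq₁.mono hsub) (fun s hs => hwdiv₁ s (hsub hs))
      (fun s hs x => linearisedNS_mono hw₁ hlin₁ hsub hU hs x)
      (hw₂.mono hsub) (hq₂.mono hsub) (fun s hs => hwdiv₂ s (hsub hs))
      (fun s hs x => linearisedNS_mono hw₂ hlin₂ hsub hU hs x) h0 ⟨hlt.le, le_rfl⟩

/-- **Exponential growth bound at integer times (Lyapunov exponents `≤ ∑ᵢ Cᵢ`).** Let `u` be
jointly smooth with divergence-free slices on `[0, ∞) × T^d` with uniform gradient bounds
`‖∂ᵢu(t, x)‖ ≤ Cᵢ` there (as along a trajectory in a compact invariant set of smooth states),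
and let `(w, q)` solve the linearised Navier–Stokes equation along `u` on `[0, ∞)` (`ν ≥ 0`).
Then for every `n : ℕ`, `∫ ‖w(n)‖² ≤ (∫ ‖w(0)‖²) · e^{2(∑ᵢ Cᵢ) n}`: the squared `L²` norm of a
linearised solution grows at most exponentially, with a rate depending on `u` only through the
gradient bounds — the a-priori bound behind the sub-exponential-growth / exponential-decay
dichotomy for the derivative cocycle `ξ ↦ v(t, u₀, ξ)` of Constantin–Foias 1988, Ch. 14,
(14.2)–(14.4). [folklore] -/
theorem linearisedNS_integral_norm_sq_nat_le_mul_exp (hν : 0 ≤ ν)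
    (hu : IsSmoothSpaceTimeOn (Ici 0) u) (hudiv : ∀ t ∈ Ici (0 : ℝ), IsDivFree (u t))
    (hw : IsSmoothSpaceTimeOn (Ici 0) w) (hq : IsSmoothSpaceTimeOn (Ici 0) q)
    (hwdiv : ∀ t ∈ Ici (0 : ℝ), IsDivFree (w t))
    (hlin : ∀ t ∈ Ici (0 : ℝ), ∀ x, timeDerivWithin (Ici 0) w t x + convect (u t) (w t) x +
      convect (w t) (u t) x = ν • laplacian (w t) x - gradient (q t) x)
    {C : d → ℝ} (hC : ∀ i, ∀ t ∈ Ici (0 : ℝ), ∀ x, ‖partialDeriv i (u t) x‖ ≤ C i) (n : ℕ) :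
    ∫ x, ‖w n x‖ ^ 2 ≤ (∫ x, ‖w 0 x‖ ^ 2) * Real.exp ((2 * ∑ i, C i) * n) := by
  have h := linearisedNS_integral_norm_sq_le_mul_exp_of_mem hν (convex_Ici 0) hu hudiv hw hq hwdiv
    hlin hC (t₀ := 0) self_mem_Ici (t := n) (Set.mem_Ici.2 (Nat.cast_nonneg n)) (Nat.cast_nonneg n)
  rwa [sub_zero] at h

/-- The same bound at all real times `t ≥ 0`: `∫ ‖w(t)‖² ≤ (∫ ‖w(0)‖²) · e^{2(∑ᵢ Cᵢ) t}`.
[folklore] -/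
theorem linearisedNS_integral_norm_sq_le_mul_exp_Ici (hν : 0 ≤ ν)
    (hu : IsSmoothSpaceTimeOn (Ici 0) u) (hudiv : ∀ t ∈ Ici (0 : ℝ), IsDivFree (u t))
    (hw : IsSmoothSpaceTimeOn (Ici 0) w) (hq : IsSmoothSpaceTimeOn (Ici 0) q)
    (hwdiv : ∀ t ∈ Ici (0 : ℝ), IsDivFree (w t))
    (hlin : ∀ t ∈ Ici (0 : ℝ), ∀ x, timeDerivWithin (Ici 0) w t x + convect (u t) (w t) x +
      convect (w t) (u t) x = ν • laplacian (w t) x - gradient (q t) x)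
    {C : d → ℝ} (hC : ∀ i, ∀ t ∈ Ici (0 : ℝ), ∀ x, ‖partialDeriv i (u t) x‖ ≤ C i)
    {t : ℝ} (ht : 0 ≤ t) :
    ∫ x, ‖w t x‖ ^ 2 ≤ (∫ x, ‖w 0 x‖ ^ 2) * Real.exp ((2 * ∑ i, C i) * t) := by
  have h := linearisedNS_integral_norm_sq_le_mul_exp_of_mem hν (convex_Ici 0) hu hudiv hw hq hwdiv
    hlin hC (t₀ := 0) self_mem_Ici (t := t) ht ht
  rwa [sub_zero] at h

/-- **Uniqueness of the linearised flow on `[0, ∞)`.** Two linearised solutions along the same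
smooth divergence-free `u` on `[0, ∞) × T^d` (`ν ≥ 0`) with the same initial value `w₁(0) = w₂(0)`
coincide for all `t ≥ 0` (so the derivative cocycle `ξ ↦ w(t)` is well defined by the initial
value; Constantin–Foias 1988, Ch. 14, (14.2) and (14.6)). [cite: ConstantinFoiasNSE1988, Ch. 14 (14.2)–(14.6)] -/
theorem linearisedNS_unique_Ici (hν : 0 ≤ ν)
    (hu : IsSmoothSpaceTimeOn (Ici 0) u) (hudiv : ∀ t ∈ Ici (0 : ℝ), IsDivFree (u t))
    (hw₁ : IsSmoothSpaceTimeOn (Ici 0) w₁) (hq₁ : IsSmoothSpaceTimeOn (Ici 0) q₁)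
    (hwdiv₁ : ∀ t ∈ Ici (0 : ℝ), IsDivFree (w₁ t))
    (hlin₁ : ∀ t ∈ Ici (0 : ℝ), ∀ x, timeDerivWithin (Ici 0) w₁ t x + convect (u t) (w₁ t) x +
      convect (w₁ t) (u t) x = ν • laplacian (w₁ t) x - gradient (q₁ t) x)
    (hw₂ : IsSmoothSpaceTimeOn (Ici 0) w₂) (hq₂ : IsSmoothSpaceTimeOn (Ici 0) q₂)
    (hwdiv₂ : ∀ t ∈ Ici (0 : ℝ), IsDivFree (w₂ t))
    (hlin₂ : ∀ t ∈ Ici (0 : ℝ), ∀ x, timeDerivWithin (Ici 0) w₂ t x + convect (u t) (w₂ t) x +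
      convect (w₂ t) (u t) x = ν • laplacian (w₂ t) x - gradient (q₂ t) x)
    (h0 : w₁ 0 = w₂ 0) {t : ℝ} (ht : 0 ≤ t) : w₁ t = w₂ t :=
  linearisedNS_unique_of_mem hν (convex_Ici 0) hu hudiv hw₁ hq₁ hwdiv₁ hlin₁ hw₂ hq₂ hwdiv₂ hlin₂
    self_mem_Ici h0 ht ht

end Anchors

end Torus

end Literature.Analysis.FunctionSpaces
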